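import Summits.Ventures.YMGap.Thresholds.HessianRootSector
import Mathlib.Analysis.SpecialFunctions.Complex.Circle
import Mathlib.LinearAlgebra.Matrix.ConjTranspose
import Mathlib.LinearAlgebra.Matrix.Trace
import Mathlib.LinearAlgebra.Matrix.NonsingularInverse
import HarnessLib

/-!
# Venture YMGap — Theorem C (sharp Hessian constant `4d`), kernel part T0.3 (diagonal holonomy):
# the single-plaquette lemma for `W = diag(e^{iθ})`

HONEST FRAMING: venture file (cell `pub-ymgap`, track (a), item A2 = "Theorem C" of
`p2/HESSIAN-SHARP.md`). This file kernel-checks Lemma 2 (SPL) of HESSIAN-SHARP §2 for DIAGONAL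
unitary plaquette holonomies `W = diag(e^{iθ_1}, …, e^{iθ_N})` — which is the whole content of SPL
once `W` is diagonalised (both sides of SPL are invariant under simultaneous conjugation
`Y_i ↦ gY_ig⁻¹`, `W ↦ gWg⁻¹`; the diagonalisability of unitary matrices is not in the pinned Mathlib
and is NOT supplied here, see `A2-PORT-SCOPE.md` §Q3 (b)). No statement about the Wilson action or
thresholds is made in this file.

SPL (HESSIAN-SHARP Lemma 2): for `W` unitary and `Y_1, …, Y_4` anti-Hermitian,
`Σ_i Re tr(Y_i² W) + 2Σ_{i<j} Re tr(Y_i Y_j W) + 2 Re tr(Y_1Y_2 + Y_2Y_3 + Y_3Y_4 + Y_1 W* Y_4 W) ≤ 2 Σ_i ‖Y_i‖_F²`.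

Proof formalised (p3's arrangement of HESSIAN-SHARP's sector decomposition): expand every trace
entrywise for diagonal `W` (`splSlack_eq_sum_pairSlack`): the slack is `Σ_{a,b} s(a,b)` over ORDERED
index pairs; symmetrise, `Σ_{a,b} s(a,b) = ½ Σ_{a,b} (s(a,b) + s(b,a))`; for each ordered pair, using
`(Y_i)_{ba} = -conj (Y_i)_{ab}`, `s(a,b) + s(b,a) = 2·pairForm(w_a, w_b, (Y_i)_{ab})`
(`pairSlack_add_swap`), and `pairForm(e^{iθ_a}, e^{iθ_b}, ζ) = rootForm(cos((θ_a+θ_b)/2), e^{-i(θ_a-θ_b)/4}, ζ)`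
(`pairForm_eq_rootForm`) is a non-negative real by T0.2 (`HessianRootSector.rootForm_nonneg`). The
diagonal pairs `a = b` need no separate treatment (they are the pair form at `θ_a = θ_b` on imaginary
entries, i.e. T0.1's diagonal sector).

Main result: `spl_diagonal`. References: `p2/HESSIAN-SHARP.md` §2; `p2/LEAN-TARGETS-A2.md` T0.3;
`HOME/lean/A2-PORT-SCOPE.md`.
-/

noncomputable section

namespace Summit.Ventures.YMGap.HessianSharp

open ComplexConjugate Complex Matrix Finset

/-! ### The pair form in terms of the two eigen-phases -/

/-- The root-sector form written with the two eigen-phases `wa = e^{iθ_a}`, `wb = e^{iθ_b}` instead of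
`(c, a)`: `p̄ = (conj wa + wb)/2` plays `c a²`, `conj wa · wb` plays `a⁴`. -/
def pairForm (wa wb : ℂ) (ζ : Fin 4 → ℂ) : ℂ :=
  (2 + (wa + conj wa + wb + conj wb) / 4) *
      (conj (ζ 0) * ζ 0 + conj (ζ 1) * ζ 1 + conj (ζ 2) * ζ 2 + conj (ζ 3) * ζ 3) +
    ((1 + (conj wa + wb) / 2) * (conj (ζ 0) * ζ 1 + conj (ζ 1) * ζ 2 + conj (ζ 2) * ζ 3) +
      (conj wa + wb) / 2 * (conj (ζ 0) * ζ 2 + conj (ζ 1) * ζ 3) +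
      ((conj wa + wb) / 2 + conj wa * wb) * (conj (ζ 0) * ζ 3)) +
    ((1 + (wa + conj wb) / 2) * (conj (ζ 1) * ζ 0 + conj (ζ 2) * ζ 1 + conj (ζ 3) * ζ 2) +
      (wa + conj wb) / 2 * (conj (ζ 2) * ζ 0 + conj (ζ 3) * ζ 1) +
      ((wa + conj wb) / 2 + wa * conj wb) * (conj (ζ 3) * ζ 0))

/-- `conj (exp (t i)) = exp (-t i)` for real `t`. -/
theorem conj_exp_mul_I (t : ℝ) : conj (exp (t * I)) = exp (-(t * I)) := by
  rw [← exp_conj, map_mul, conj_ofReal, conj_I, mul_neg]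

/-- **Change of parameters**: with `wa = e^{iθ_a}`, `wb = e^{iθ_b}`, `c = cos((θ_a+θ_b)/2)` and
`a = e^{-i(θ_a-θ_b)/4}` one has `c a² = (conj wa + wb)/2` and `a⁴ = conj wa · wb`, so the pair form IS
the root-sector form of `HessianRootSector`. -/
theorem pairForm_eq_rootForm (θa θb : ℝ) (ζ : Fin 4 → ℂ) :
    pairForm (exp (θa * I)) (exp (θb * I)) ζ =
      rootForm (Real.cos ((θa + θb) / 2) : ℂ) (exp (-((θa - θb) / 4) * I)) ζ := by
  -- quarter-angle exponentials
  set ea : ℂ := exp ((θa / 4 : ℝ) * I) with hea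
  set eb : ℂ := exp ((θb / 4 : ℝ) * I) with heb
  have hea0 : ea ≠ 0 := exp_ne_zero _
  have heb0 : eb ≠ 0 := exp_ne_zero _
  have hwa : exp (θa * I) = ea ^ 4 := by
    rw [hea, ← exp_nat_mul]; congr 1; push_cast; ring
  have hwb : exp (θb * I) = eb ^ 4 := by
    rw [heb, ← exp_nat_mul]; congr 1; push_cast; ring
  have hcwa : conj (exp (θa * I)) = (ea ^ 4)⁻¹ := by
    rw [conj_exp_mul_I, exp_neg, hwa]
  have hcwb : conj (exp (θb * I)) = (eb ^ 4)⁻¹ := by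
    rw [conj_exp_mul_I, exp_neg, hwb]
  have haq : exp (-((θa - θb) / 4) * I) = ea⁻¹ * eb := by
    rw [hea, heb, ← exp_neg, ← exp_add]; congr 1; push_cast; ring
  have hcaq : conj (exp (-((θa - θb) / 4) * I)) = ea * eb⁻¹ := by
    rw [show (-((θa - θb) / 4) : ℂ) * I = ((-((θa - θb) / 4) : ℝ) : ℂ) * I by push_cast; ring,
      conj_exp_mul_I, hea, heb, ← exp_neg, ← exp_add]
    congr 1; push_cast; ring
  have hc : (Real.cos ((θa + θb) / 2) : ℂ) = ((ea * eb) ^ 2 + ((ea * eb) ^ 2)⁻¹) / 2 := by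
    rw [ofReal_cos, Complex.cos, hea, heb, ← exp_add, ← exp_nat_mul, ← exp_neg]
    congr 2 <;> (congr 1; push_cast; ring)
  rw [pairForm, rootForm, hcwa, hcwb, hwa, hwb, hcaq, haq, hc]
  field_simp
  ring

/-- **The pair form is a non-negative real** (T0.2 transported): for all angles `θ_a, θ_b` and all
`ζ ∈ ℂ⁴`. -/
theorem pairForm_nonneg (θa θb : ℝ) (ζ : Fin 4 → ℂ) :
    ∃ r : ℝ, 0 ≤ r ∧ pairForm (exp (θa * I)) (exp (θb * I)) ζ = (r : ℂ) := by
  rw [pairForm_eq_rootForm]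
  refine rootForm_nonneg (Real.neg_one_le_cos _) (Real.cos_le_one _) ?_ ζ
  rw [show (-((θa - θb) / 4) : ℂ) * I = ((-((θa - θb) / 4) : ℝ) : ℂ) * I by push_cast; ring]
  exact norm_exp_ofReal_mul_I _

/-! ### Ordered index pairs: the share of one pair `(a,b)` in the two sides of SPL -/

/-- The complex expression whose real part is the share of the ORDERED index pair `(a,b)` in the
left side of SPL when `W = diag(w)`: `x_i = (Y_i)_{ab}`, `y_i = (Y_i)_{ba}`. -/
def pairLHS (wa wb : ℂ) (x y : Fin 4 → ℂ) : ℂ :=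
  (x 0 * y 0 + x 1 * y 1 + x 2 * y 2 + x 3 * y 3) * wa +
    2 * (x 0 * y 1 + x 0 * y 2 + x 0 * y 3 + x 1 * y 2 + x 1 * y 3 + x 2 * y 3) * wa +
    2 * (x 0 * y 1 + x 1 * y 2 + x 2 * y 3) + 2 * (x 0 * conj wb * y 3 * wa)

/-- The share of the ordered pair `(a,b)` in the slack `RHS - LHS` of SPL. -/
def pairSlack (wa wb : ℂ) (x y : Fin 4 → ℂ) : ℝ :=
  2 * (normSq (x 0) + normSq (x 1) + normSq (x 2) + normSq (x 3)) - (pairLHS wa wb x y).re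

/-- **Pairing `(a,b)` with `(b,a)`**: for anti-Hermitian entries `y_i = -conj x_i` the two ordered
shares add up to twice the (real) pair form. Pure algebra in real and imaginary parts. -/
theorem pairSlack_add_swap (wa wb : ℂ) (x : Fin 4 → ℂ) :
    pairSlack wa wb x (fun i => -conj (x i)) + pairSlack wb wa (fun i => -conj (x i)) x =
      2 * (pairForm wa wb x).re := by
  simp only [pairSlack, pairLHS, pairForm, normSq_apply, Complex.add_re,
    Complex.mul_re, Complex.mul_im, Complex.add_im, Complex.neg_re, Complex.neg_im,
    Complex.conj_re, Complex.conj_im, Complex.div_re, Complex.div_im,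
    Complex.re_ofNat, Complex.im_ofNat, Complex.one_re, Complex.one_im]
  ring

/-- Hence each symmetrised pair share is non-negative when the phases are unimodular. -/
theorem pairSlack_add_swap_nonneg (θa θb : ℝ) (x : Fin 4 → ℂ) :
    0 ≤ pairSlack (exp (θa * I)) (exp (θb * I)) x (fun i => -conj (x i)) +
        pairSlack (exp (θb * I)) (exp (θa * I)) (fun i => -conj (x i)) x := by
  rw [pairSlack_add_swap]
  obtain ⟨r, hr, h⟩ := pairForm_nonneg θa θb x
  rw [h, ofReal_re]
  linarith

/-! ### Trace expansions for a diagonal holonomy (sums over ordered index pairs) -/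

section Traces

variable {N : ℕ}

/-- `tr(A B diag(w)) = Σ_{(a,b)} A_{ab} B_{ba} w_a`. -/
theorem trace_mul_mul_diagonal (A B : Matrix (Fin N) (Fin N) ℂ) (w : Fin N → ℂ) :
    (A * B * diagonal w).trace = ∑ p : Fin N × Fin N, A p.1 p.2 * B p.2 p.1 * w p.1 := by
  rw [Fintype.sum_prod_type]
  unfold Matrix.trace
  simp only [Matrix.diag_apply, Matrix.mul_diagonal]
  simp only [Matrix.mul_apply, Finset.sum_mul]

/-- `tr(A diag(w)ᴴ B diag(w)) = Σ_{(a,b)} A_{ab} conj(w_b) B_{ba} w_a`. -/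
theorem trace_mul_conjTranspose_diagonal_mul_mul_diagonal (A B : Matrix (Fin N) (Fin N) ℂ)
    (w : Fin N → ℂ) :
    (A * (diagonal w)ᴴ * B * diagonal w).trace =
      ∑ p : Fin N × Fin N, A p.1 p.2 * conj (w p.2) * B p.2 p.1 * w p.1 := by
  rw [Fintype.sum_prod_type, Matrix.diagonal_conjTranspose]
  unfold Matrix.trace
  simp only [Matrix.diag_apply, Matrix.mul_diagonal]
  refine Finset.sum_congr rfl fun a _ => ?_
  rw [Matrix.mul_apply, Finset.sum_mul]
  refine Finset.sum_congr rfl fun b _ => ?_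
  rw [Matrix.mul_diagonal, Pi.star_apply, Complex.star_def]

/-- `‖Y‖_F² = Σ_{(a,b)} |Y_{ab}|²` as a sum over ordered pairs. -/
theorem sum_sum_normSq_eq_sum_prod (Y : Matrix (Fin N) (Fin N) ℂ) :
    ∑ a, ∑ b, normSq (Y a b) = ∑ p : Fin N × Fin N, normSq (Y p.1 p.2) := by
  rw [Fintype.sum_prod_type]

end Traces

/-! ### SPL for a diagonal unitary holonomy -/

/-- Symmetrisation of a sum over ordered pairs: `Σ_p s(p) = ½ Σ_p (s(p) + s(swap p))`. -/
theorem sum_prod_eq_half_sum_add_swap {N : ℕ} (s : Fin N × Fin N → ℝ) :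
    ∑ p : Fin N × Fin N, s p = (1 / 2) * ∑ p : Fin N × Fin N, (s p + s p.swap) := by
  have hswap : ∑ p : Fin N × Fin N, s p.swap = ∑ p : Fin N × Fin N, s p :=
    Fintype.sum_equiv (Equiv.prodComm (Fin N) (Fin N)) _ _ fun p => rfl
  rw [Finset.sum_add_distrib, hswap]
  ring

/-- The left side of SPL for a holonomy `W` and link variables `Y_0..Y_3` (HESSIAN-SHARP (SPL)):
`Σ_i Re tr(Y_i² W) + 2Σ_{i<j} Re tr(Y_i Y_j W) + 2 Re tr(Y_0Y_1 + Y_1Y_2 + Y_2Y_3 + Y_0 Wᴴ Y_3 W)`. -/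
def splLHS {N : ℕ} (W : Matrix (Fin N) (Fin N) ℂ) (Y : Fin 4 → Matrix (Fin N) (Fin N) ℂ) : ℝ :=
  (((Y 0 * Y 0 * W).trace + (Y 1 * Y 1 * W).trace + (Y 2 * Y 2 * W).trace + (Y 3 * Y 3 * W).trace) +
      2 * ((Y 0 * Y 1 * W).trace + (Y 0 * Y 2 * W).trace + (Y 0 * Y 3 * W).trace +
          (Y 1 * Y 2 * W).trace + (Y 1 * Y 3 * W).trace + (Y 2 * Y 3 * W).trace) +
      2 * ((Y 0 * Y 1).trace + (Y 1 * Y 2).trace + (Y 2 * Y 3).trace + (Y 0 * Wᴴ * Y 3 * W).trace)).re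

/-- The squared Frobenius norm `‖Y‖_F² = Σ_{a,b} |Y_{ab}|²`. -/
def frobNormSq {N : ℕ} (Y : Matrix (Fin N) (Fin N) ℂ) : ℝ := ∑ a, ∑ b, normSq (Y a b)

/-- **The single-plaquette lemma for `W = diag(e^{iθ})`** (HESSIAN-SHARP Lemma 2, diagonal case):
for anti-Hermitian `Y_0, …, Y_3 ∈ M_N(ℂ)` and `W = diag(e^{iθ_1}, …, e^{iθ_N})`,
`Σ_i Re tr(Y_i² W) + 2Σ_{i<j} Re tr(Y_i Y_j W) + 2 Re tr(Y_0Y_1 + Y_1Y_2 + Y_2Y_3 + Y_0 W* Y_3 W)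
  ≤ 2 Σ_i ‖Y_i‖_F²`. -/
theorem spl_diagonal {N : ℕ} (θ : Fin N → ℝ) (Y : Fin 4 → Matrix (Fin N) (Fin N) ℂ)
    (hY : ∀ i, (Y i)ᴴ = -Y i) :
    splLHS (diagonal fun a => exp (θ a * I)) Y ≤ 2 * ∑ i, frobNormSq (Y i) := by
  unfold splLHS frobNormSq
  -- anti-Hermitian entries: `Y_i b a = -conj (Y_i a b)`
  have hanti : ∀ i a b, Y i b a = -conj (Y i a b) := fun i a b => by
    have h := congr_fun (congr_fun (hY i) b) a
    rw [conjTranspose_apply, Matrix.neg_apply] at h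
    have h' : Y i b a = -star (Y i a b) := by rw [h, neg_neg]
    simpa using h'
  set w : Fin N → ℂ := fun a => exp (θ a * I) with hw
  -- Step 1: the left side as ONE sum over ordered pairs
  have hL : ((Y 0 * Y 0 * diagonal w).trace + (Y 1 * Y 1 * diagonal w).trace +
            (Y 2 * Y 2 * diagonal w).trace + (Y 3 * Y 3 * diagonal w).trace) +
        2 * ((Y 0 * Y 1 * diagonal w).trace + (Y 0 * Y 2 * diagonal w).trace +
            (Y 0 * Y 3 * diagonal w).trace + (Y 1 * Y 2 * diagonal w).trace +
            (Y 1 * Y 3 * diagonal w).trace + (Y 2 * Y 3 * diagonal w).trace) +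
        2 * ((Y 0 * Y 1).trace + (Y 1 * Y 2).trace + (Y 2 * Y 3).trace +
            (Y 0 * (diagonal w)ᴴ * Y 3 * diagonal w).trace) =
      ∑ p : Fin N × Fin N, pairLHS (w p.1) (w p.2) (fun i => Y i p.1 p.2) (fun i => Y i p.2 p.1) := by
    have htr : ∀ A B : Matrix (Fin N) (Fin N) ℂ,
        (A * B).trace = ∑ p : Fin N × Fin N, A p.1 p.2 * B p.2 p.1 := fun A B => by
      rw [Fintype.sum_prod_type]
      unfold Matrix.trace
      simp only [Matrix.diag_apply, Matrix.mul_apply]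
    simp only [trace_mul_conjTranspose_diagonal_mul_mul_diagonal]
    simp only [trace_mul_mul_diagonal]
    simp only [htr]
    simp only [mul_add, Finset.mul_sum, ← Finset.sum_add_distrib]
    refine Finset.sum_congr rfl fun p _ => ?_
    simp only [pairLHS]
    ring
  -- Step 2: the right side as ONE sum over ordered pairs
  have hR : 2 * ∑ i, ∑ a, ∑ b, normSq (Y i a b) =
      ∑ p : Fin N × Fin N, 2 * (normSq (Y 0 p.1 p.2) + normSq (Y 1 p.1 p.2) +
        normSq (Y 2 p.1 p.2) + normSq (Y 3 p.1 p.2)) := by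
    simp only [sum_sum_normSq_eq_sum_prod, Fin.sum_univ_four, Finset.mul_sum,
      ← Finset.sum_add_distrib, mul_add]
  -- Step 3: slack = Σ_p pairSlack, symmetrise, each symmetrised term ≥ 0
  rw [← sub_nonneg, hL, hR, Complex.re_sum, ← Finset.sum_sub_distrib]
  have hs : ∑ p : Fin N × Fin N, (2 * (normSq (Y 0 p.1 p.2) + normSq (Y 1 p.1 p.2) +
        normSq (Y 2 p.1 p.2) + normSq (Y 3 p.1 p.2)) -
        (pairLHS (w p.1) (w p.2) (fun i => Y i p.1 p.2) (fun i => Y i p.2 p.1)).re) =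
      ∑ p : Fin N × Fin N, pairSlack (w p.1) (w p.2) (fun i => Y i p.1 p.2) (fun i => Y i p.2 p.1) :=
    Finset.sum_congr rfl fun p _ => by simp only [pairSlack]
  rw [hs, sum_prod_eq_half_sum_add_swap]
  refine mul_nonneg (by norm_num) (Finset.sum_nonneg fun p _ => ?_)
  have hx : (fun i => Y i p.2 p.1) = fun i => -conj (Y i p.1 p.2) := funext fun i => hanti i p.1 p.2
  simp only [Prod.fst_swap, Prod.snd_swap, hx, hw]
  exact pairSlack_add_swap_nonneg (θ p.1) (θ p.2) fun i => Y i p.1 p.2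

/-! ### Reduction of a unitarily diagonalised holonomy to the diagonal case -/

section Conj

variable {N : ℕ}

/-- `‖Y‖_F² = Re tr(Y Yᴴ)`. -/
theorem frobNormSq_eq_trace (Y : Matrix (Fin N) (Fin N) ℂ) : frobNormSq Y = ((Y * Yᴴ).trace).re := by
  unfold frobNormSq Matrix.trace
  rw [Complex.re_sum]
  refine Finset.sum_congr rfl fun a _ => ?_
  rw [Matrix.diag_apply, Matrix.mul_apply, Complex.re_sum]
  refine Finset.sum_congr rfl fun b _ => ?_
  rw [conjTranspose_apply, Complex.star_def, Complex.mul_conj, Complex.ofReal_re]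

/-- Frobenius norm is invariant under unitary conjugation. -/
theorem frobNormSq_conj {g : Matrix (Fin N) (Fin N) ℂ} (hg : gᴴ * g = 1) (A : Matrix (Fin N) (Fin N) ℂ) :
    frobNormSq (g * A * gᴴ) = frobNormSq A := by
  rw [frobNormSq_eq_trace, frobNormSq_eq_trace, conjTranspose_mul, conjTranspose_mul,
    conjTranspose_conjTranspose]
  have : g * A * gᴴ * (g * (Aᴴ * gᴴ)) = g * (A * Aᴴ) * gᴴ := by
    calc g * A * gᴴ * (g * (Aᴴ * gᴴ)) = g * A * (gᴴ * g) * (Aᴴ * gᴴ) := by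
          simp only [Matrix.mul_assoc]
      _ = g * (A * Aᴴ) * gᴴ := by rw [hg]; simp only [Matrix.mul_one, Matrix.mul_assoc]
  rw [this, Matrix.trace_mul_cycle, hg, Matrix.one_mul]

/-- `tr(g A gᴴ) = tr A` for `gᴴ g = 1`. -/
theorem trace_conj {g : Matrix (Fin N) (Fin N) ℂ} (hg : gᴴ * g = 1) (A : Matrix (Fin N) (Fin N) ℂ) :
    (g * A * gᴴ).trace = A.trace := by
  rw [Matrix.trace_mul_cycle, hg, Matrix.one_mul]

/-- Products of conjugates: `(gAgᴴ)(gBgᴴ) = g(AB)gᴴ`. -/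
theorem conj_mul_conj {g : Matrix (Fin N) (Fin N) ℂ} (hg : gᴴ * g = 1)
    (A B : Matrix (Fin N) (Fin N) ℂ) : g * A * gᴴ * (g * B * gᴴ) = g * (A * B) * gᴴ := by
  calc g * A * gᴴ * (g * B * gᴴ) = g * A * (gᴴ * g) * B * gᴴ := by simp only [Matrix.mul_assoc]
    _ = g * (A * B) * gᴴ := by rw [hg]; simp only [Matrix.mul_one, Matrix.mul_assoc]

/-- **SPL for a unitarily diagonalised holonomy** `W = g · diag(e^{iθ}) · gᴴ`, `gᴴg = 1`: both sides
of SPL are invariant under `Y_i ↦ gᴴY_ig`, `W ↦ gᴴWg`, so `spl_diagonal` applies. (Every unitary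
matrix is of this form — the spectral theorem for unitary/normal matrices, not in the pinned Mathlib;
it enters Theorem C as a named hypothesis, see `A2-PORT-SCOPE.md` §Q3 (b).) -/
theorem spl_of_unitary_conj_diagonal (g : Matrix (Fin N) (Fin N) ℂ) (hg : gᴴ * g = 1)
    (θ : Fin N → ℝ) (Y : Fin 4 → Matrix (Fin N) (Fin N) ℂ) (hY : ∀ i, (Y i)ᴴ = -Y i) :
    splLHS (g * (diagonal fun a => exp (θ a * I)) * gᴴ) Y ≤ 2 * ∑ i, frobNormSq (Y i) := by
  have hg' : g * gᴴ = 1 := mul_eq_one_comm.1 hg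
  -- the conjugated link variables
  set Y' : Fin 4 → Matrix (Fin N) (Fin N) ℂ := fun i => gᴴ * Y i * g with hY'def
  have hY' : ∀ i, (Y' i)ᴴ = -Y' i := fun i => by
    simp only [hY'def, conjTranspose_mul, conjTranspose_conjTranspose, hY i, Matrix.neg_mul,
      Matrix.mul_neg, Matrix.mul_assoc]
  have hYY : ∀ i, Y i = g * Y' i * gᴴ := fun i => by
    simp only [hY'def]
    calc Y i = (g * gᴴ) * Y i * (g * gᴴ) := by rw [hg', Matrix.one_mul, Matrix.mul_one]
      _ = g * (gᴴ * Y i * g) * gᴴ := by simp only [Matrix.mul_assoc]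
  set D : Matrix (Fin N) (Fin N) ℂ := diagonal fun a => exp (θ a * I) with hD
  have key := spl_diagonal θ Y' hY'
  -- both sides are conjugation invariant
  have hfrob : ∀ i, frobNormSq (Y i) = frobNormSq (Y' i) := fun i => by rw [hYY i, frobNormSq_conj hg]
  have hL : splLHS (g * D * gᴴ) Y = splLHS D Y' := by
    unfold splLHS
    have h2 : ∀ i j, (Y i * Y j * (g * D * gᴴ)).trace = (Y' i * Y' j * D).trace := fun i j => by
      rw [hYY i, hYY j, conj_mul_conj hg, conj_mul_conj hg, trace_conj hg]
    have h3 : ∀ i j, (Y i * Y j).trace = (Y' i * Y' j).trace := fun i j => by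
      rw [hYY i, hYY j, conj_mul_conj hg, trace_conj hg]
    have h4 : (Y 0 * (g * D * gᴴ)ᴴ * Y 3 * (g * D * gᴴ)).trace = (Y' 0 * Dᴴ * Y' 3 * D).trace := by
      have hc : (g * D * gᴴ)ᴴ = g * Dᴴ * gᴴ := by
        rw [conjTranspose_mul, conjTranspose_mul, conjTranspose_conjTranspose, Matrix.mul_assoc]
      rw [hc, hYY 0, hYY 3, conj_mul_conj hg, conj_mul_conj hg, conj_mul_conj hg, trace_conj hg]
    simp only [h2, h3, h4]
  rw [hL, Finset.sum_congr rfl fun i _ => hfrob i]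
  exact key

end Conj

end Summit.Ventures.YMGap.HessianSharp
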